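import Literature.NumberTheory.Automorphic.ReductiveDualChevalleyBasedProofs
import Literature.NumberTheory.Automorphic.DualGroupIsSplitProofs
import Literature.NumberTheory.Automorphic.BorelOfBaseMaximal
import HarnessLib

open scoped IsMulCommutative

/-!
# Borel's construction of the L-group: reduction of `exists_dualGroupStr` (lang.S13 (d)) to Chevalley's theorems

Proof file for `Literature.NumberTheory.Automorphic.ReductiveDual`, item (d) (namespace
`Literature.NumberTheory.Automorphic`; concrete `k`-points vocabulary of items I1–I3:
`LinearAlgebraicGroups`, `RootData`, `DualGroup`). The named fact
`Literature.NumberTheory.Automorphic.exists_dualGroupStr` (Borel, *Automorphic L-functions*,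
Corvallis 1979, §I.2 (2.1)–(2.4); Buzzard–Gee 2014, §2.1) says: for every reduced based root
datum `(P, b)` and every action `a : Γ_F → Aut(P, b)` with open kernel there is an L-group datum
`L` (`Ĝ = L.dual ≤ GL_N(ℂ)`, `ᴸG = Ĝ ⋊ Γ_F`) with a dual group structure `D : L.DualGroupStr P b`
(`Ĝ` connected reductive with maximal torus `T̂`, Borel `B̂`, based root datum `(P^∨, b^∨)`, a
pinning, and `L.galAct` the L-action) whose Galois action on the root datum is `a`. In print
this is a *construction from* two theorems which Borel quotes: Chevalley's existence theorem
(a connected reductive `Ĝ/ℂ` with `Ψ₀(Ĝ) = Ψ₀(G)^∨` exists) and the isomorphism theorem in its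
pinned form (the splitting `Aut Ψ₀(Ĝ) → Aut(Ĝ, B̂, T̂, {u_α})`, SGA 3 XXIV 3.10, Springer's
Corvallis article 2.13–2.14, Springer *LAG* 16.3.2–16.3.3), through which `μ_G = a` is lifted to
an action of `Γ_F` on `Ĝ`. This file **proves that construction**: the main theorem
`exists_dualGroupStr_of` derives `exists_dualGroupStr` from the tree's named facts
`chevalley_existence` (Springer 10.1.1), `chevalley_isomorphism` (9.6.2 / 16.3.2, equal data) and
`isBorelIn_borelOfBase` (8.2.4 (i)), all three at `k = ℂ`. No new named fact is introduced.

* **Transport of structure** (`IsRootDatumOf.twist`): if `(G, T)` realizes `P^∨` through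
  `eX : X*(T) ≃ Y`, `eY : X_*(T) ≃ X`, then for `θ ∈ Aut P` it realizes `P^∨` through
  `(θ ∘ eX, θ ∘ eY)` (`twistX`, `twistY`; `θ` acting covariantly on coweights by `autCoweightAct`
  of `DualGroup.lean`, on weights by Mathlib's `RootPairing.Equiv.weightEquiv`). Based
  automorphisms permute the positive (co)roots (`height_perm_eq`, `isPos_flip_indexHom_iff`,
  via Mathlib's `RootPairing.Base.height`).
* **Pinned automorphisms** (`IsPinnedAut p θ f`): `f` is an automorphism of the algebraic group
  `G` with `f T = T`, inducing `θ` on `X*(T) = Y` and permuting the pinning `p = (u_i)` through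
  `θ` — literally the compatibilities `isAlgebraic_galAct`, `galAct_torus`, `galAct_char`,
  `galAct_pinning` of `LGroupData.DualGroupStr`. Proved: `refl`, `trans`, `symm_trans`, the
  stability of `B(b^∨) = ⟨T, U_{α^∨} : α^∨ > 0⟩` (`mem_borelOfBase`, i.e. `galAct_borel` for the
  canonical Borel subgroup `borelOfBase` of `ReductiveDualChevalleyBasedProofs.lean`), and
  **uniqueness** (`eq_refl_of_one`, `unique`): over an algebraically closed field of
  characteristic `0` a pinned automorphism attached to `θ = 1` is the identity — Springer's proof
  of 9.6.2 (`IsRootDatumOf.mulEquiv_eq_conj_of_forall_apply_eq` of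
  `IsomorphismTheoremUniqueProofs.lean`), whose leaves 8.1.1 (i)–(ii) hold in characteristic `0`
  by the Lie-algebra route of `IsomorphismTheoremUniqueLie.lean` / `RootSpaceLine.lean` /
  `LieCentralizerTorus.lean` (`IsRootDatumOf.rootSubgroup_unique_of_charZero`,
  `IsRootDatumOf.torus_sup_rootSubgroups_eq_of_charZero`), then "the roots kill `t`"
  (`forall_roots_apply_eq_one_of_conj_pinning`).
* **Existence, granted the isomorphism theorem** (`IsPinnedAut.exists`): `chevalley_isomorphism`
  applied to the plain and the `θ`-twisted realization gives `f₀` inducing `θ`; `f₀ ∘ u_i` is a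
  root homomorphism for `α^∨_{θ i}`, so `f₀ (u_i(x)) = u_{θ i}(c_i x)` (8.1.1 (i)); a torus
  element `t₀` with `α^∨_{θ i}(t₀) = c_i⁻¹` exists (`exists_forall_charOfWeight_root_eq`: simple
  roots are linearly independent, `kˣ` is divisible, `T = Hom(X*(T), 𝔾ₘ)`), and
  `f = Int(t₀) ∘ f₀` is pinned. By uniqueness `θ ↦ f` is a homomorphism
  `pinnedLift : Aut(P, b) →* Aut(G)` — the L-action attached to the pinning (Borel §2.1).
* **Assembly** (`exists_dualGroupStr_of`): `Ĝ, T̂` from `chevalley_existence ℂ` for `P.flip`,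
  `B̂ = borelOfBase` (a Borel subgroup by `isBorelIn_borelOfBase`, with
  `isBasedRootDatumOf_borelOfBase`), the pinning `IsRootDatumOf.pinning`, `galAct = pinnedLift ∘ a`
  (kernel `⊇ ker a`, open by `Subgroup.isOpen_mono`), `galRoot = a`.

Remaining DAG for `exists_dualGroupStr_holds`: the three leaves `chevalley_existence` (ℂ),
`chevalley_isomorphism` (ℂ; itself reduced in `ReductiveDualProofs.lean`) and
`isBorelIn_borelOfBase` (ℂ; reduced in `ReductiveDualChevalleyBasedProofs.lean`); then
`exists_dualGroupStr_holds := exists_dualGroupStr_of chevalley_existence_holds … …`.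

**Update (two leaves).** The third leaf is a theorem in characteristic `0`:
`isBorelIn_borelOfBase_of_charZero` (`BorelOfBaseMaximal.lean`, Springer 8.2.4 (i) by the
dimension count through the Lie algebra). Hence `exists_dualGroupStr_of_chevalley`:
`exists_dualGroupStr` follows from `chevalley_existence` and `chevalley_isomorphism` at `k = ℂ`
alone — exactly the two theorems quoted by Borel in Corvallis §I.2 — and
`exists_dualGroupStr_holds` awaits only `chevalley_existence_holds` (Springer 10.1.1) and
`chevalley_isomorphism_holds` (9.6.2 / 16.3.2).

## On faithfulness

* Borel §I.2 / Buzzard–Gee §2.1 define `ᴸG°` as *a* complex connected reductive group *equipped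
  with* an isomorphism `Ψ₀(ᴸG°) ≅ Ψ₀(G)^∨`, and the L-action through a chosen splitting
  (pinning); the vendored `exists_dualGroupStr` asks for exactly these data
  (`LGroupData.DualGroupStr`), so the statement is the printed construction and is not mis-stated.
  The canonical identification `Aut Ψ₀(G) = Aut Ψ₀(G)^∨` ("inserting an inverse to cancel the
  contravariance", Buzzard–Gee) is the covariant coweight action `autCoweightAct` fixed by
  `DualGroup.lean`; `IsRootDatumOf.twist` and `IsPinnedAut.trans` confirm that the conventions of
  `galAct_char` and `galAct_pinning` are mutually consistent (a left action).
* The Borel subgroup is the canonical `B(b^∨) = T̂ · ⟨U_{α^∨}, α^∨ > 0⟩`, so that Galois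
  stability (`galAct_borel`) is automatic; that it *is* a Borel subgroup is Springer 8.2.4 (i)
  (`isBorelIn_borelOfBase`). The Borel subgroup offered by `chevalley_existence_based` is a mere
  choice and would not be Galois stable, which is why the unbased `chevalley_existence` is used.
* Everything up to the assembly is proved over any algebraically closed field of
  characteristic `0` (the uniqueness through the Lie algebra); the assembly is at `k = ℂ`, as
  `LGroupData` demands.

## References

* [BorelCorvallis1979] A. Borel, *Automorphic L-functions*, Proc. Sympos. Pure Math. 33.2
  (Corvallis 1979), §I.1.2–1.3, §I.2 (2.1)–(2.4).
* [SpringerLAG1998] T. A. Springer, *Linear Algebraic Groups*, 2nd ed., Birkhäuser (1998):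
  8.1.1, 8.1.2, 8.2.4 (i), Thm. 9.6.2 and its proof (p. 179), 10.1.1, 16.3.1–16.3.3.
* K. Buzzard, T. Gee, *The conjectural connections between automorphic representations and
  Galois representations*, LMS LNS 414 (2014), §2.1 (arXiv:1009.0785, p. 5).
* M. Demazure, A. Grothendieck, *SGA 3*, Exp. XXI 6.1, XXIII 4.1, XXIV 3.10.
-/

noncomputable section

open Field
open scoped MatrixGroups

namespace Literature.NumberTheory.Automorphic

/-! ### Based automorphisms preserve the height, hence the positive roots -/

section Height

variable {ι R M N : Type*} [CommRing R] [CharZero R] [AddCommGroup M] [Module R M]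
  [AddCommGroup N] [Module R N] {P : RootPairing ι R M N}

/-- If a permutation `π` of the roots of `P` preserving the simple roots of a base `b` is induced
by an additive map `L` of the weight lattice (`L α_i = α_{π i}`), then `π` preserves the
`b`-height: writing `α_i = ∑_{j ∈ Δ} f_j α_j`, one has `α_{π i} = ∑_{j ∈ Δ} f_j α_{π j}`, a sum
over the same simple roots (SGA 3 XXI 6.1; Bourbaki, *Lie* VI §1.7). [folklore] -/
theorem height_perm_eq (b : P.Base) (π : ι ≃ ι) (L : M →+ M)
    (hL : ∀ i, L (P.root i) = P.root (π i)) (hπ : ∀ i, π i ∈ b.support ↔ i ∈ b.support)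
    (i : ι) : b.height (π i) = b.height i := by
  classical
  obtain ⟨f, -, -, hf⟩ := b.exists_root_eq_sum_int i
  have hf' : P.root (π i) = ∑ j ∈ b.support, f (π.symm j) • P.root j := by
    rw [← hL, hf, map_sum]
    simp_rw [map_zsmul, hL]
    exact Finset.sum_equiv π (fun j => (hπ j).symm) (fun j _ => by rw [Equiv.symm_apply_apply])
  rw [RootPairing.Base.height_eq_sum hf', RootPairing.Base.height_eq_sum hf]
  exact (Finset.sum_equiv π (fun j => (hπ j).symm)
    (fun j _ => by rw [Equiv.symm_apply_apply])).symm

/-- Under the hypotheses of `height_perm_eq`, `π` permutes the `b`-positive roots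
(Mathlib `RootPairing.Base.IsPos`). [folklore] -/
theorem isPos_perm_iff (b : P.Base) (π : ι ≃ ι) (L : M →+ M)
    (hL : ∀ i, L (P.root i) = P.root (π i)) (hπ : ∀ i, π i ∈ b.support ↔ i ∈ b.support)
    (i : ι) : b.IsPos (π i) ↔ b.IsPos i := by
  rw [RootPairing.Base.isPos_iff, RootPairing.Base.isPos_iff, height_perm_eq b π L hL hπ i]

end Height

/-! ### The covariant coweight action: functoriality -/

section CoweightAct

variable {ι R M N : Type*} [CommRing R] [AddCommGroup M] [Module R M] [AddCommGroup N]
  [Module R N] {P : RootPairing ι R M N}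

/-- The identity acts trivially on coweights. [folklore] -/
@[simp] lemma autCoweightAct_one_apply (y : N) : autCoweightAct (1 : P.Aut) y = y := by
  rw [autCoweightAct_apply, LinearEquiv.symm_apply_eq]
  rfl

/-- The covariant coweight action is a (left) action: `(e f) • y = e • (f • y)`. [folklore] -/
lemma autCoweightAct_mul_apply (e f : P.Aut) (y : N) :
    autCoweightAct (e * f) y = autCoweightAct e (autCoweightAct f y) := by
  simp only [autCoweightAct, RootPairing.Equiv.mul_eq_comp,
    RootPairing.Equiv.coweightEquiv_comp_toLin, LinearEquiv.trans_symm, LinearEquiv.trans_apply]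

/-- The inverse of the covariant action of `e` on coweights is Mathlib's (contravariant)
coweight map of `e`; on coroots: `e⁻¹ • α_i^∨ = α^∨_{e⁻¹ i}`. [folklore] -/
lemma autCoweightAct_symm_coroot (e : P.Aut) (i : ι) :
    (autCoweightAct e).symm (P.coroot i) = P.coroot (e.toHom.indexEquiv.symm i) := by
  rw [autCoweightAct, LinearEquiv.symm_symm, RootPairing.Equiv.coweightEquiv_apply,
    RootPairing.Hom.coroot_coweightMap_apply]

/-- On roots, the inverse weight map of `e` is `α_i ↦ α_{e⁻¹ i}`. [folklore] -/
lemma weightEquiv_symm_root (e : P.Aut) (i : ι) :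
    (RootPairing.Equiv.weightEquiv P P e).symm (P.root i) = P.root (e.toHom.indexEquiv.symm i) := by
  rw [LinearEquiv.symm_apply_eq, RootPairing.Equiv.weightEquiv_apply,
    RootPairing.Hom.root_weightMap_apply, Equiv.apply_symm_apply]

/-- A based automorphism (`basedAutGroup P b`) permutes the `b.flip`-positive coroots, i.e. the
positive roots of the dual based root datum `(P^∨, Δ^∨)`. [folklore] -/
theorem isPos_flip_indexHom_iff [CharZero R] {b : P.Base} (θ : ↥(basedAutGroup P b)) (i : ι) :
    b.flip.IsPos (RootPairing.Equiv.indexHom P (θ : P.Aut) i) ↔ b.flip.IsPos i :=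
  isPos_perm_iff b.flip (RootPairing.Equiv.indexHom P (θ : P.Aut))
    (autCoweightAct (θ : P.Aut)).toAddMonoidHom
    (fun j => autCoweightAct_coroot (θ : P.Aut) j) (fun j => θ.2 j) i

end CoweightAct

/-! ### Twisting a realization of the dual root datum by an automorphism of `P` -/

section Twist

variable {k : Type*} [Field k] {n : Type*} [Fintype n] [DecidableEq n]
variable {ι X Y : Type*} [AddCommGroup X] [AddCommGroup Y]
variable {G T : Subgroup (GL n k)}
variable {P : RootPairing ι ℤ X Y}

/-- The identification `X*(T) ≃ Y` twisted by the covariant coweight action of `θ ∈ Aut P`: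
`χ ↦ θ • eX χ`. [folklore] -/
def twistX (eX : Additive ↥(characterLattice T) ≃+ Y) (θ : P.Aut) :
    Additive ↥(characterLattice T) ≃+ Y :=
  eX.trans (autCoweightAct θ).toAddEquiv

/-- Unfolding `twistX`. [folklore] -/
@[simp] lemma twistX_apply (eX : Additive ↥(characterLattice T) ≃+ Y) (θ : P.Aut)
    (χ : Additive ↥(characterLattice T)) : twistX eX θ χ = autCoweightAct θ (eX χ) := rfl

/-- The character of the twisted coweight `θ • y` for the twisted identification is the character
of `y`: `χ'_{θ • y} = χ_y`. [folklore] -/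
lemma charOfWeight_twistX (eX : Additive ↥(characterLattice T) ≃+ Y) (θ : P.Aut) (y : Y) :
    charOfWeight (twistX eX θ) (autCoweightAct θ y) = charOfWeight eX y := by
  change ((Additive.toMul (eX.symm ((autCoweightAct θ).symm (autCoweightAct θ y))) :
    ↥(characterLattice T)) : ↥T →* kˣ) = _
  rw [LinearEquiv.symm_apply_apply]
  rfl

/-- For the twisted identification, the character of the coroot `α_i^∨` is the old character of
`α^∨_{θ⁻¹ i}`. [folklore] -/
lemma charOfWeight_twistX_coroot (eX : Additive ↥(characterLattice T) ≃+ Y) (θ : P.Aut) (i : ι) :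
    charOfWeight (twistX eX θ) (P.coroot i) =
      charOfWeight eX (P.coroot (θ.toHom.indexEquiv.symm i)) := by
  rw [← autCoweightAct_symm_coroot, ← charOfWeight_twistX eX θ, LinearEquiv.apply_symm_apply]

variable [IsMulCommutative ↥T]

/-- The identification `X_*(T) ≃ X` twisted by the weight action of `θ ∈ Aut P`. [folklore] -/
def twistY (eY : Additive ↥(cocharacterLattice T) ≃+ X) (θ : P.Aut) :
    Additive ↥(cocharacterLattice T) ≃+ X :=
  eY.trans (RootPairing.Equiv.weightEquiv P P θ).toAddEquiv

/-- Unfolding `twistY`. [folklore] -/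
@[simp] lemma twistY_apply (eY : Additive ↥(cocharacterLattice T) ≃+ X) (θ : P.Aut)
    (γ : Additive ↥(cocharacterLattice T)) :
    twistY eY θ γ = RootPairing.Equiv.weightEquiv P P θ (eY γ) := rfl

/-- For the twisted identification, the cocharacter of the root `α_i` is the old cocharacter of
`α_{θ⁻¹ i}`. [folklore] -/
lemma cocharOfCoweight_twistY_root (eY : Additive ↥(cocharacterLattice T) ≃+ X) (θ : P.Aut)
    (i : ι) :
    cocharOfCoweight (twistY eY θ) (P.root i) =
      cocharOfCoweight eY (P.root (θ.toHom.indexEquiv.symm i)) := by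
  change ((Additive.toMul (eY.symm ((RootPairing.Equiv.weightEquiv P P θ).symm (P.root i))) :
    ↥(cocharacterLattice T)) : kˣ →* ↥T) = _
  rw [weightEquiv_symm_root]
  rfl

/-- **Twisting a realization of the dual root datum.** If `(G, T)` realizes the dual root datum
`P^∨ = P.flip` through `eX : X*(T) ≃ Y`, `eY : X_*(T) ≃ X`, then for every automorphism `θ` of
`P` it also realizes `P^∨` through the twisted identifications `(θ ∘ eX, θ ∘ eY)` (`θ` acting
covariantly on `Y` and `X`): the pairing is preserved (`⟨θ x, θ y⟩ = ⟨x, y⟩`), `θ` permutes the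
coroots, and the `SL₂` of `α^∨_{θ⁻¹ i}` serves `α_i^∨` (SGA 3 XXI 6.1; Springer 16.3.2, proof:
transport of structure). [folklore] -/
theorem IsRootDatumOf.twist {eX : Additive ↥(characterLattice T) ≃+ Y}
    {eY : Additive ↥(cocharacterLattice T) ≃+ X} (h : IsRootDatumOf G T P.flip eX eY)
    (θ : P.Aut) : IsRootDatumOf G T P.flip (twistX eX θ) (twistY eY θ) where
  le := h.le
  pairing_eq χ γ := by
    rw [twistX_apply, twistY_apply, ← h.pairing_eq χ γ]
    exact toLinearMap_smul_autCoweightAct θ _ _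
  range_root := by
    ext y
    simp only [RootPairing.flip_root, Set.mem_range, Set.mem_image, twistX_apply]
    constructor
    · rintro ⟨i, rfl⟩
      have hmem : P.coroot (θ.toHom.indexEquiv.symm i) ∈ Set.range P.flip.root := ⟨_, rfl⟩
      rw [h.range_root] at hmem
      obtain ⟨α, hα, hαi⟩ := hmem
      refine ⟨α, hα, ?_⟩
      change eX (Additive.ofMul α) = _ at hαi
      rw [hαi, ← autCoweightAct_symm_coroot θ i, LinearEquiv.apply_symm_apply]
    · rintro ⟨α, hα, rfl⟩
      have hmem : eX (Additive.ofMul α) ∈ Set.range P.flip.root := by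
        rw [h.range_root]; exact ⟨α, hα, rfl⟩
      obtain ⟨i, hi⟩ := hmem
      refine ⟨θ.toHom.indexEquiv i, ?_⟩
      rw [← hi, RootPairing.flip_root, autCoweightAct_coroot]
      rfl
  exists_sl2Hom i := by
    obtain ⟨φ, hφ, hu, hl, hd⟩ := h.exists_sl2Hom (θ.toHom.indexEquiv.symm i)
    refine ⟨φ, hφ, ?_, ?_, fun t => ?_⟩
    · rw [RootPairing.flip_root, charOfWeight_twistX_coroot]; exact hu
    · rw [RootPairing.flip_root, charOfWeight_twistX_coroot]; exact hl
    · rw [RootPairing.flip_coroot, cocharOfCoweight_twistY_root]; exact hd t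

end Twist


/-! ### Prescribing the values of the simple roots on the torus -/

section TorusValues

variable {k : Type*} [Field k] {n : Type*} [Fintype n] [DecidableEq n]
variable {ι M L : Type*} [AddCommGroup M] [AddCommGroup L]
variable {T : Subgroup (GL n k)}

/-- **The simple roots take arbitrary prescribed values on a torus.** Let `T` be a torus over an
algebraically closed field, `eX : X*(T) ≃ M` an identification of its character group with the
weight lattice of a root datum `Q` and `Δ = c.support` a base. For any family `d : Δ → kˣ` there
is `t ∈ T` with `α_j(t) = d_j` for all simple roots `α_j` (Springer, proof of 9.6.2, p. 179:
"there exists `t ∈ T` with `α(t) = c_α` for `α ∈ D`"): the simple roots are linearly independent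
(Mathlib `RootPairing.Base.linearIndepOn_root`), `kˣ` is divisible
(`exists_extend_addMonoidHom_units`) and `T = Hom(X*(T), 𝔾ₘ)`
(`IsTorusSubgroup.exists_forall_char_apply_eq`). [cite: SpringerLAG1998, Thm. 9.6.2 (proof)] -/
theorem exists_forall_charOfWeight_root_eq [IsAlgClosed k] (hT : IsTorusSubgroup T)
    {Q : RootPairing ι ℤ M L} (eX : Additive ↥(characterLattice T) ≃+ M) (c : Q.Base)
    (d : ↥c.support → kˣ) :
    ∃ t : ↥T, ∀ j : ↥c.support, charOfWeight eX (Q.root (j : ι)) t = d j := by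
  classical
  have hli : LinearIndependent ℤ (fun j : ↥c.support => Q.root (j : ι)) := c.linearIndepOn_root
  let B := Module.Basis.span hli
  let g : ↥(Submodule.span ℤ (Set.range fun j : ↥c.support => Q.root (j : ι))) →ₗ[ℤ]
      Additive kˣ := B.constr ℤ fun j => Additive.ofMul (d j)
  obtain ⟨F, hF⟩ := exists_extend_addMonoidHom_units (k := k)
    (Submodule.span ℤ (Set.range fun j : ↥c.support => Q.root (j : ι))).toAddSubgroup
    g.toAddMonoidHom
  let f : ↥(characterLattice T) →* kˣ :=
    AddMonoidHom.toMultiplicative (F.comp eX.toAddMonoidHom)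
  obtain ⟨t, ht⟩ := hT.exists_forall_char_apply_eq f
  refine ⟨t, fun j => ?_⟩
  have h1 := ht (Additive.toMul (eX.symm (Q.root (j : ι))))
  have hBj : (B j : M) = Q.root (j : ι) := congrArg Subtype.val (Module.Basis.span_apply hli j)
  have hmemj : Q.root (j : ι) ∈ Submodule.span ℤ (Set.range fun j : ↥c.support => Q.root (j : ι)) :=
    Submodule.subset_span ⟨j, rfl⟩
  have h2 : F (Q.root (j : ι)) = Additive.ofMul (d j) := by
    have e1 := hF ⟨Q.root (j : ι), hmemj⟩
    have e2 : (⟨Q.root (j : ι), hmemj⟩ : ↥(Submodule.span ℤ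
        (Set.range fun j : ↥c.support => Q.root (j : ι)))) = B j :=
      Subtype.ext hBj.symm
    rw [e1, LinearMap.toAddMonoidHom_coe, e2]
    exact B.constr_basis ℤ (fun j => Additive.ofMul (d j)) j
  have h3 : f (Additive.toMul (eX.symm (Q.root (j : ι)))) = d j := by
    change Additive.toMul (F (eX (Additive.ofMul (Additive.toMul (eX.symm (Q.root (j : ι))))))) =
      d j
    rw [ofMul_toMul, AddEquiv.apply_symm_apply, h2, toMul_ofMul]
  rw [h3] at h1
  exact h1

end TorusValues

/-! ### The two leaves of the structure theory, in characteristic `0`, from the Lie algebra -/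

section Leaves

variable {k : Type*} [Field k] {n : Type*} [Fintype n] [DecidableEq n]
variable {ι M L : Type*} [AddCommGroup M] [AddCommGroup L]
variable {G T : Subgroup (GL n k)} [IsMulCommutative ↥T]
variable {Q : RootPairing ι ℤ M L} {eX : Additive ↥(characterLattice T) ≃+ M}
  {eY : Additive ↥(cocharacterLattice T) ≃+ L}

/-- **Root spaces are lines** (Springer 8.1.2) for a connected reductive `(G, T)` carrying a root
datum, over an algebraically closed field of characteristic `0`: every root `α` of `(G, T)` is
`χ_{Q.root i}` for some `i` (`IsRootDatumOf.range_root`), `𝔤^T ⊆ Lie(T)`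
(`lieWeightSpace_one_le_lieAlgebraGL_of_charZero`, Springer 5.4.7 with 7.6.4 (ii)) and
`finrank_lieWeightSpace_le_one_of_lieWeightSpace_one_le` (`RootSpaceLine.lean`) applies. This is
`finrank_lieWeightSpace_le_one_of_mem_roots` of `DualGroupIsSplitProofs.lean` without the
dual-group packaging. [cite: SpringerLAG1998, Cor. 8.1.2] -/
theorem IsRootDatumOf.finrank_lieWeightSpace_le_one [IsAlgClosed k] [CharZero k]
    (hG : IsConnectedReductive G) (hT : IsMaximalTorusIn T G) (h : IsRootDatumOf G T Q eX eY)
    {α : ↥(characterLattice T)} (hα : α ∈ roots G T) :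
    Module.finrank k ↥(lieWeightSpace G T (α : ↥T →* kˣ)) ≤ 1 := by
  have hmem : eX (Additive.ofMul α) ∈ Set.range Q.root := by
    rw [h.range_root]
    exact ⟨α, hα, rfl⟩
  obtain ⟨i, hi⟩ := hmem
  have hci : charOfWeight eX (Q.root i) = (α : ↥T →* kˣ) := by
    rw [hi]; simp [charOfWeight]
  rw [← hci]
  exact finrank_lieWeightSpace_le_one_of_lieWeightSpace_one_le hG hT
    (lieWeightSpace_one_le_lieAlgebraGL_of_charZero hG hT) h i

/-- **Springer 8.1.1 (i) in characteristic `0`**: for a connected reductive `(G, T)` carrying a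
root datum over an algebraically closed field of characteristic `0`, the root subgroups are unique
(`rootSubgroup_unique`, whose own hypotheses supply the algebraically closed field, `G`
connected reductive and `T` a maximal torus), by `rootSubgroup_unique_of_finrank_le_one` and 8.1.2
(`IsRootDatumOf.finrank_lieWeightSpace_le_one`). [cite: SpringerLAG1998, 8.1.1 (i) and 8.1.2] -/
theorem IsRootDatumOf.rootSubgroup_unique_of_charZero [CharZero k] (h : IsRootDatumOf G T Q eX eY) :
    rootSubgroup_unique (G := G) (T := T) := by
  intro _ hG hT α hα u hu
  exact rootSubgroup_unique_of_finrank_le_one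
    (fun _ hβ => h.finrank_lieWeightSpace_le_one hG hT hβ) hG hT hα hu

/-- **Springer 8.1.1 (ii) in characteristic `0`**: for a connected reductive `(G, T)` carrying a
root datum over an algebraically closed field of characteristic `0`, `T` and the root subgroups
generate `G` (`torus_sup_rootSubgroups_eq_of_lieWeights_subset` with `lieWeights_subset_roots`,
8.1.2 and 5.4.7 / 7.6.4 (ii)). [cite: SpringerLAG1998, 8.1.1 (ii) with 8.1.2 and 5.4.7] -/
theorem IsRootDatumOf.torus_sup_rootSubgroups_eq_of_charZero [IsAlgClosed k] [CharZero k]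
    (hG : IsConnectedReductive G) (hT : IsMaximalTorusIn T G) (h : IsRootDatumOf G T Q eX eY) :
    T ⊔ ⨆ α ∈ roots G T, rootSubgroup G T (α : ↥T →* kˣ) = G :=
  torus_sup_rootSubgroups_eq_of_lieWeights_subset hG.1 hT.2.1 hT.1
    (lieWeights_subset_roots hG.1.1 hT.2.1.1 hT.1)
    (fun _ hα => h.finrank_lieWeightSpace_le_one hG hT hα)
    (lieWeightSpace_one_le_lieAlgebraGL_of_charZero hG hT)

end Leaves

/-! ### Pinned automorphisms attached to based automorphisms of the root datum -/

section Pinned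

variable {k : Type*} [Field k] {n : Type*} [Fintype n] [DecidableEq n]
variable {ι X Y : Type*} [AddCommGroup X] [AddCommGroup Y]
variable {G T : Subgroup (GL n k)}
variable {P : RootPairing ι ℤ X Y} {b : P.Base}
variable {eX : Additive ↥(characterLattice T) ≃+ Y}
variable {hTG : T ≤ G}

/-- The permutation of the simple (co)roots `Δ^∨ = b.flip.support = Δ` induced by a based
automorphism `θ ∈ Aut(P, b)` (SGA 3 XXI 6.1; Borel, Corvallis 1979, §1.2). [folklore] -/
def basedIndex (θ : ↥(basedAutGroup P b)) (i : ↥b.flip.support) : ↥b.flip.support :=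
  ⟨RootPairing.Equiv.indexHom P (θ : P.Aut) i, (θ.2 (i : ι)).mpr i.2⟩

/-- The underlying index of `basedIndex θ i` is `θ i`. [folklore] -/
@[simp] lemma coe_basedIndex (θ : ↥(basedAutGroup P b)) (i : ↥b.flip.support) :
    (basedIndex θ i : ι) = RootPairing.Equiv.indexHom P (θ : P.Aut) i := rfl

/-- `basedIndex 1 = id`. [folklore] -/
@[simp] lemma basedIndex_one (i : ↥b.flip.support) : basedIndex (1 : ↥(basedAutGroup P b)) i = i :=
  Subtype.ext (by simp [basedIndex])

/-- `basedIndex` is multiplicative. [folklore] -/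
lemma basedIndex_mul (θ₁ θ₂ : ↥(basedAutGroup P b)) (i : ↥b.flip.support) :
    basedIndex (θ₁ * θ₂) i = basedIndex θ₁ (basedIndex θ₂ i) :=
  Subtype.ext (by simp [basedIndex])

/-- **Pinned automorphisms.** Let `(G, T)` realize the dual root datum `P^∨` through `eX, eY`,
with a pinning `p = (u_i)_{i ∈ Δ}` relative to the base `Δ^∨ = b.flip`, and let
`θ ∈ Aut(P, b) = Aut(P^∨, b^∨)` be a based automorphism. An automorphism `f` of the abstract group
`G` is *the pinned automorphism attached to `θ`* if it is an automorphism of the algebraic group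
`G` (polynomial coordinates in both directions) mapping `T` onto `T`, inducing `θ` on
`X*(T) = Y` — `χ_{θ • y}(f t) = χ_y(t)`, `θ` acting covariantly on the coweights `Y` of `P`
(`autCoweightAct`) — and permuting the pinning through `θ`: `f ∘ u_i = u_{θ i}`. This is the image
of `θ` under the splitting `Aut Ψ₀(G) → Aut(G, B, T, {u_α})` of Borel, Corvallis 1979, §2.1 /
SGA 3 XXIV 3.10 / Springer 16.3.3 (proof of 2.13–2.14 in Springer's Corvallis article); these are
exactly the compatibilities `isAlgebraic_galAct`, `galAct_torus`, `galAct_char`, `galAct_pinning`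
demanded of an L-action by `LGroupData.DualGroupStr`. [cite: BorelCorvallis1979, §1.2 and §2.1] -/
structure IsPinnedAut (p : Pinning G T hTG P.flip b.flip eX) (θ : ↥(basedAutGroup P b))
    (f : ↥G ≃* ↥G) : Prop where
  /-- `f` has polynomial coordinates. -/
  isAlgebraic : MonoidHom.IsAlgebraicGL (G.subtype.comp f.toMonoidHom)
  /-- `f⁻¹` has polynomial coordinates. -/
  isAlgebraic_symm : MonoidHom.IsAlgebraicGL (G.subtype.comp f.symm.toMonoidHom)
  /-- `f` maps `T` onto `T`. -/
  mem_iff : ∀ g : ↥G, ((f g : ↥G) : GL n k) ∈ T ↔ (g : GL n k) ∈ T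
  /-- `f` induces `θ` on `X*(T) = Y`: `χ_{θ • y} (f t) = χ_y (t)`. -/
  charOfWeight_eq : ∀ (y : Y) (t : ↥G) (ht : (t : GL n k) ∈ T),
    charOfWeight eX (autCoweightAct (θ : P.Aut) y) ⟨((f t : ↥G) : GL n k), (mem_iff t).mpr ht⟩ =
      charOfWeight eX y ⟨(t : GL n k), ht⟩
  /-- `f` permutes the pinning through `θ`: `f (u_i (x)) = u_{θ i} (x)`. -/
  rootHom_eq : ∀ (i : ↥b.flip.support) (x : Multiplicative k),
    f (p.rootHom i x) = p.rootHom (basedIndex θ i) x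

namespace IsPinnedAut

variable {p : Pinning G T hTG P.flip b.flip eX}

/-- The identity is the pinned automorphism attached to `θ = 1`. [folklore] -/
theorem refl (p : Pinning G T hTG P.flip b.flip eX) : IsPinnedAut p 1 (MulEquiv.refl ↥G) where
  isAlgebraic := isAlgebraicGL_subtype_comp_refl
  isAlgebraic_symm := isAlgebraicGL_subtype_comp_refl
  mem_iff _ := Iff.rfl
  charOfWeight_eq y t ht := by
    rw [OneMemClass.coe_one, autCoweightAct_one_apply]
    rfl
  rootHom_eq i x := by rw [basedIndex_one]; rfl

/-- Pinned automorphisms compose: if `f₁, f₂` are attached to `θ₁, θ₂` then `f₁ ∘ f₂` is attached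
to `θ₁ θ₂`. [folklore] -/
theorem trans {θ₁ θ₂ : ↥(basedAutGroup P b)} {f₁ f₂ : ↥G ≃* ↥G} (h₁ : IsPinnedAut p θ₁ f₁)
    (h₂ : IsPinnedAut p θ₂ f₂) : IsPinnedAut p (θ₁ * θ₂) (f₂.trans f₁) where
  isAlgebraic := by
    obtain ⟨Q, hQ⟩ := h₂.isAlgebraic.comp_of_subtype_comp h₁.isAlgebraic
    exact ⟨Q, fun g c => hQ g c⟩
  isAlgebraic_symm := by
    obtain ⟨Q, hQ⟩ := h₁.isAlgebraic_symm.comp_of_subtype_comp h₂.isAlgebraic_symm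
    exact ⟨Q, fun g c => hQ g c⟩
  mem_iff g := by
    rw [MulEquiv.trans_apply, h₁.mem_iff, h₂.mem_iff]
  charOfWeight_eq y t ht := by
    have e₂ := h₂.charOfWeight_eq y t ht
    have e₁ := h₁.charOfWeight_eq (autCoweightAct (θ₂ : P.Aut) y) (f₂ t) ((h₂.mem_iff t).mpr ht)
    rw [← e₂, ← e₁, Subgroup.coe_mul, autCoweightAct_mul_apply]
    rfl
  rootHom_eq i x := by
    rw [MulEquiv.trans_apply, h₂.rootHom_eq, h₁.rootHom_eq, basedIndex_mul]

/-- Two pinned automorphisms `f, f'` attached to the same `θ` differ by a pinned automorphism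
`f⁻¹ ∘ f'` attached to `1`. [folklore] -/
theorem symm_trans {θ : ↥(basedAutGroup P b)} {f f' : ↥G ≃* ↥G} (h₁ : IsPinnedAut p θ f)
    (h₂ : IsPinnedAut p θ f') : IsPinnedAut p 1 (f'.trans f.symm) where
  isAlgebraic := by
    obtain ⟨Q, hQ⟩ := h₂.isAlgebraic.comp_of_subtype_comp h₁.isAlgebraic_symm
    exact ⟨Q, fun g c => hQ g c⟩
  isAlgebraic_symm := by
    obtain ⟨Q, hQ⟩ := h₁.isAlgebraic.comp_of_subtype_comp h₂.isAlgebraic_symm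
    exact ⟨Q, fun g c => hQ g c⟩
  mem_iff g := by
    rw [MulEquiv.trans_apply, ← h₁.mem_iff, MulEquiv.apply_symm_apply, h₂.mem_iff]
  charOfWeight_eq y t ht := by
    have hs : ((f.symm (f' t) : ↥G) : GL n k) ∈ T := by
      rw [← h₁.mem_iff, MulEquiv.apply_symm_apply, h₂.mem_iff]; exact ht
    have e₁ := h₁.charOfWeight_eq y (f.symm (f' t)) hs
    have e₂ := h₂.charOfWeight_eq y t ht
    simp only [MulEquiv.apply_symm_apply] at e₁
    rw [e₁] at e₂
    rw [OneMemClass.coe_one, autCoweightAct_one_apply]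
    exact e₂
  rootHom_eq i x := by
    rw [MulEquiv.trans_apply, h₂.rootHom_eq, ← h₁.rootHom_eq, MulEquiv.symm_apply_apply,
      basedIndex_one]

/-- A pinned automorphism maps the group `B(b^∨) = ⟨T, U_{α^∨} : α^∨ > 0⟩` (`borelOfBase` for the
dual based root datum) into itself: `f(T) = T`, and `f` carries a root homomorphism for the
positive coroot `α_i^∨` to one for `θ • α_i^∨ = α^∨_{θ i}` (`IsRootHom.comp_mulEquiv`), which is
again positive because `θ` is based (`isPos_flip_indexHom_iff`). With `B̂ = B(b^∨)` this is the
compatibility `galAct_borel` of `LGroupData.DualGroupStr` (Borel, Corvallis 1979, §2.1: the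
L-action preserves `B̂`). [cite: BorelCorvallis1979, §2.1] -/
theorem mem_borelOfBase {θ : ↥(basedAutGroup P b)} {f : ↥G ≃* ↥G} (hf : IsPinnedAut p θ f)
    (g : ↥G) (hg : (g : GL n k) ∈ borelOfBase G T P.flip b.flip eX) :
    ((f g : ↥G) : GL n k) ∈ borelOfBase G T P.flip b.flip eX := by
  let K : Subgroup (GL n k) :=
    ((borelOfBase G T P.flip b.flip eX).comap (G.subtype.comp f.toMonoidHom)).map G.subtype
  suffices hle : borelOfBase G T P.flip b.flip eX ≤ K by
    obtain ⟨g', hg', hgg'⟩ := hle hg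
    obtain rfl : g' = g := Subtype.ext hgg'
    exact hg'
  refine sup_le ?_ (iSup₂_le fun i hi => ?_)
  · intro t ht
    refine ⟨⟨t, hTG ht⟩, ?_, rfl⟩
    change ((f ⟨t, hTG ht⟩ : ↥G) : GL n k) ∈ borelOfBase G T P.flip b.flip eX
    exact le_borelOfBase G T P.flip b.flip eX ((hf.mem_iff _).mpr ht)
  · unfold rootSubgroup
    refine iSup₂_le fun hTG' u => iSup_le fun hu => ?_
    rintro _ ⟨y, ⟨x, rfl⟩, rfl⟩
    refine ⟨u x, ?_, rfl⟩
    change ((f (u x) : ↥G) : GL n k) ∈ borelOfBase G T P.flip b.flip eX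
    have hu' : IsRootHom G T hTG
        (charOfWeight eX (P.flip.root (RootPairing.Equiv.indexHom P (θ : P.Aut) i)))
        (f.toMonoidHom.comp u) := by
      refine hu.comp_mulEquiv f hf.isAlgebraic hf.isAlgebraic_symm hf.mem_iff (fun t ht => ?_)
      rw [RootPairing.flip_root, ← autCoweightAct_coroot]
      exact hf.charOfWeight_eq _ t ht
    have hpos : b.flip.IsPos (RootPairing.Equiv.indexHom P (θ : P.Aut) i) :=
      (isPos_flip_indexHom_iff θ i).mpr hi
    refine rootSubgroup_le_borelOfBase G T P.flip eX hpos ?_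
    unfold rootSubgroup
    refine Subgroup.mem_iSup_of_mem hTG (Subgroup.mem_iSup_of_mem (f.toMonoidHom.comp u)
      (Subgroup.mem_iSup_of_mem hu' ?_))
    exact ⟨f (u x), ⟨x, rfl⟩, rfl⟩

end IsPinnedAut

/-- **The roots kill a torus element fixing the pinning.** If conjugation by `t ∈ T` fixes the
pinned root homomorphisms `u_i` (`i ∈ Δ^∨`), then every root of `(G, T)` is trivial on `t`:
`u_i(α_i^∨(t) x) = t u_i(x) t⁻¹ = u_i(x)` and `u_i` is injective, so `α_i^∨(t) = 1` for the simple
roots `α_i^∨` of `(G, T)`, and every root of `(G, T)` is a root of `P^∨`, i.e. an integral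
combination of simple ones (Mathlib `RootPairing.Base.coroot_mem_span_int`). (Springer, proof of
9.6.2; the lemma `forall_roots_eq_one_of_conj_rootHom` of `IsomorphismTheoremUnique.lean` without
the dual-group packaging.) [cite: SpringerLAG1998, Thm. 9.6.2 (proof)] -/
theorem forall_roots_apply_eq_one_of_conj_pinning [IsMulCommutative ↥T]
    {eY : Additive ↥(cocharacterLattice T) ≃+ X} (h : IsRootDatumOf G T P.flip eX eY)
    (p : Pinning G T hTG P.flip b.flip eX) {t : ↥G} (htT : (t : GL n k) ∈ T)
    (hfix : ∀ (i : ↥b.flip.support) (x : Multiplicative k),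
      t * p.rootHom i x * t⁻¹ = p.rootHom i x) :
    ∀ α ∈ roots G T, (α : ↥T →* kˣ) ⟨(t : GL n k), htT⟩ = 1 := by
  -- simple roots
  have hsimple : ∀ i : ↥b.flip.support,
      charOfWeight eX (P.flip.root i) ⟨(t : GL n k), htT⟩ = 1 := by
    intro i
    obtain ⟨-, ⟨q, hq⟩, hconj⟩ := p.isRootHom i
    have h1 := hconj ⟨(t : GL n k), htT⟩ 1
    have hincl : Subgroup.inclusion hTG ⟨(t : GL n k), htT⟩ = t := rfl
    rw [hincl, mul_one, hfix i] at h1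
    have h2 := congrArg (fun y : ↥G => MvPolynomial.eval (glCoordFun (y : GL n k)) q) h1
    simp only [hq] at h2
    exact Units.ext (by simpa using h2.symm)
  -- the evaluation homomorphism `y ↦ χ_y(t)` on `Y`
  let ev : Y →+ Additive kˣ :=
    { toFun := fun y => Additive.ofMul (charOfWeight eX y ⟨(t : GL n k), htT⟩)
      map_zero' := by simp [charOfWeight]
      map_add' := fun y y' => by simp [charOfWeight_add', ofMul_mul] }
  have hev : ∀ y, ev y = Additive.ofMul (charOfWeight eX y ⟨(t : GL n k), htT⟩) := fun _ => rfl
  have hker : ∀ y ∈ Submodule.span ℤ (P.coroot '' (b.support : Set ι)), ev y = 0 := by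
    intro y hy
    induction hy using Submodule.span_induction with
    | mem y hy =>
      obtain ⟨i, hi, rfl⟩ := hy
      rw [hev, ofMul_eq_zero]
      exact hsimple ⟨i, hi⟩
    | zero => exact map_zero ev
    | add y y' _ _ hy hy' => rw [map_add, hy, hy', add_zero]
    | smul z y _ hy => rw [map_zsmul, hy, smul_zero]
  -- all roots
  intro α hα
  have hmem : eX (Additive.ofMul α) ∈ Set.range P.flip.root := by
    rw [h.range_root]
    exact ⟨α, hα, rfl⟩
  obtain ⟨j, hj⟩ := hmem
  have key := hker (P.coroot j) (b.coroot_mem_span_int j)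
  rw [hev, ofMul_eq_zero] at key
  have e : charOfWeight eX (eX (Additive.ofMul α)) = (α : ↥T →* kˣ) := by simp [charOfWeight]
  rw [← e, ← hj]
  exact key

namespace IsPinnedAut

variable {p : Pinning G T hTG P.flip b.flip eX} [IsMulCommutative ↥T]
  {eY : Additive ↥(cocharacterLattice T) ≃+ X}

/-- **Uniqueness of pinned automorphisms** (Springer 9.6.2, uniqueness; Borel, Corvallis 1979,
§2.1: an automorphism of `(Ĝ, B̂, T̂, {u_α})` inducing the identity of `Ψ₀` is the identity).
Over an algebraically closed field of characteristic `0`, for `(G, T)` connected reductive with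
maximal torus `T` realizing `P^∨`: a pinned automorphism attached to `θ = 1` is the identity.
Proof: it fixes the characters of `T`, which separate points (`eq_of_forall_char_apply_eq`), so
it fixes `T` pointwise and is `Int(t)`, `t ∈ T`, by the printed proof of 9.6.2
(`IsRootDatumOf.mulEquiv_eq_conj_of_forall_apply_eq`; its leaves 8.1.1 (i)–(ii) hold in
characteristic `0` by the Lie algebra, `IsRootDatumOf.rootSubgroup_unique_of_charZero`,
`IsRootDatumOf.torus_sup_rootSubgroups_eq_of_charZero`, and 8.2.10 is
`IsRootDatumOf.torus_sup_rootSubgroups_base_eq_of_sup_eq`); `Int(t)` fixes the pinning, so the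
roots kill `t` (`forall_roots_apply_eq_one_of_conj_pinning`) and `Int(t)` is trivial on `T` and on
every root subgroup, which generate `G`. [cite: SpringerLAG1998, Thm. 9.6.2 (proof)] -/
theorem eq_refl_of_one [IsAlgClosed k] [CharZero k] [Finite ι] (hG : IsConnectedReductive G)
    (hT : IsMaximalTorusIn T G) (h : IsRootDatumOf G T P.flip eX eY) {f : ↥G ≃* ↥G}
    (hf : IsPinnedAut p 1 f) : f = MulEquiv.refl ↥G := by
  classical
  haveI : P.flip.IsReduced := RootPairing.isReduced_of_base_int b.flip
  have hU : rootSubgroup_unique (G := G) (T := T) := h.rootSubgroup_unique_of_charZero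
  have hgen₀ := h.torus_sup_rootSubgroups_eq_of_charZero hG hT
  have hgen := h.torus_sup_rootSubgroups_base_eq_of_sup_eq b.flip hgen₀
  -- `f` fixes `T` pointwise: it fixes the characters, which separate the points of `T`
  have hfix : ∀ g : ↥G, (g : GL n k) ∈ T → f g = g := by
    intro g hg
    have e : (⟨((f g : ↥G) : GL n k), (hf.mem_iff g).mpr hg⟩ : ↥T) = ⟨(g : GL n k), hg⟩ :=
      eq_of_forall_char_apply_eq hT.2.1.2.2 fun χ => by
        have key := hf.charOfWeight_eq (eX (Additive.ofMul χ)) g hg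
        rw [OneMemClass.coe_one, autCoweightAct_one_apply] at key
        simpa [charOfWeight] using key
    exact Subtype.ext (congrArg (fun s : ↥T => (s : GL n k)) e)
  obtain ⟨t, htT, ht⟩ := h.mulEquiv_eq_conj_of_forall_apply_eq b.flip.support
    b.flip.linearIndepOn_root hU hgen hG hT f hf.isAlgebraic hf.isAlgebraic_symm hfix
  -- the roots kill `t`
  have hroots := forall_roots_apply_eq_one_of_conj_pinning h p htT fun i x => by
    rw [← ht, hf.rootHom_eq, basedIndex_one]
  -- `Int(t)` is the identity on `T` (commutative) and on every root subgroup, hence on `G`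
  have hle : T ⊔ ⨆ α ∈ roots G T, rootSubgroup G T (α : ↥T →* kˣ) ≤
      Subgroup.centralizer {(t : GL n k)} := by
    refine sup_le (fun s hs => ?_) (iSup₂_le fun α hα =>
      rootSubgroup_le_centralizer_of_apply_eq_one htT (hroots α hα))
    rw [Subgroup.mem_centralizer_iff]
    intro m hm
    rw [Set.mem_singleton_iff.mp hm]
    have hc := hT.2.1.2.1.is_comm.comm (⟨(t : GL n k), htT⟩ : ↥T) ⟨s, hs⟩
    exact congrArg Subtype.val hc
  refine MulEquiv.ext fun g => ?_
  have hg : (g : GL n k) ∈ T ⊔ ⨆ α ∈ roots G T, rootSubgroup G T (α : ↥T →* kˣ) := by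
    rw [hgen₀]
    exact g.2
  have hcomm := Subgroup.mem_centralizer_iff.mp (hle hg) _ rfl
  rw [MulEquiv.refl_apply, ht g, mul_inv_eq_iff_eq_mul]
  exact Subtype.ext hcomm

/-- **Pinned automorphisms are unique**: two pinned automorphisms attached to the same based
automorphism `θ` coincide (`f⁻¹ ∘ f'` is attached to `1`, `symm_trans`, hence the identity,
`eq_refl_of_one`). (Borel, Corvallis 1979, §2.1; Springer 9.6.2.)
[cite: SpringerLAG1998, Thm. 9.6.2] -/
theorem unique [IsAlgClosed k] [CharZero k] [Finite ι] (hG : IsConnectedReductive G)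
    (hT : IsMaximalTorusIn T G) (h : IsRootDatumOf G T P.flip eX eY) {θ : ↥(basedAutGroup P b)}
    {f f' : ↥G ≃* ↥G} (hf : IsPinnedAut p θ f) (hf' : IsPinnedAut p θ f') : f = f' := by
  have key := eq_refl_of_one hG hT h (hf.symm_trans hf')
  refine MulEquiv.ext fun g => ?_
  have e := MulEquiv.congr_fun key g
  rw [MulEquiv.trans_apply, MulEquiv.refl_apply] at e
  exact (f.symm_apply_eq.mp e).symm

end IsPinnedAut

end Pinned

/-! ### Existence of pinned automorphisms, granted the isomorphism theorem -/

section Existence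

variable {k : Type*} [Field k] {N : ℕ}
variable {ι X Y : Type*} [AddCommGroup X] [AddCommGroup Y]
variable {G T : Subgroup (GL (Fin N) k)} [IsMulCommutative ↥T]
variable {P : RootPairing ι ℤ X Y} {b : P.Base}
variable {eX : Additive ↥(characterLattice T) ≃+ Y} {eY : Additive ↥(cocharacterLattice T) ≃+ X}
variable {hTG : T ≤ G}

/-- **Existence of pinned automorphisms, granted Chevalley's isomorphism theorem** (Borel,
Corvallis 1979, §2.1; Springer 16.3.2–16.3.3; SGA 3 XXIV 3.10: `Aut(G, B, T, {u_α}) → Aut Ψ₀(G)`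
is onto). Let `(G, T)` be connected reductive with maximal torus `T` over an algebraically closed
field of characteristic `0`, realizing `P^∨` through `(eX, eY)`, with a pinning `p`, and let
`θ ∈ Aut(P, b)`. By transport of structure `(G, T)` also realizes `P^∨` through the twisted
identifications `(θ ∘ eX, θ ∘ eY)` (`IsRootDatumOf.twist`), so the isomorphism theorem for equal
data (the named fact `chevalley_isomorphism`, Springer 9.6.2 / 16.3.2) provides an automorphism
`f₀` of the algebraic group `G` with `f₀ T = T` inducing `θ` on `X*(T)`. Then `f₀ ∘ u_i` is a root
homomorphism for `α^∨_{θ i}`, hence `f₀ (u_i(x)) = u_{θ i}(c_i x)` for scalars `c_i ∈ kˣ`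
(8.1.1 (i), `rootSubgroup_unique.existsUnique_mul`); choosing `t₀ ∈ T` with
`α^∨_{θ i}(t₀) = c_i⁻¹` (`exists_forall_charOfWeight_root_eq`), `f = Int(t₀) ∘ f₀` is the pinned
automorphism attached to `θ`. [cite: BorelCorvallis1979, §2.1] -/
theorem IsPinnedAut.exists [IsAlgClosed k] [CharZero k]
    (hiso : chevalley_isomorphism (k := k) (ι := ι) (X := Y) (Y := X) (G := G) (T := T) (G' := G)
      (T' := T))
    (hG : IsConnectedReductive G) (hT : IsMaximalTorusIn T G) (h : IsRootDatumOf G T P.flip eX eY)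
    (p : Pinning G T hTG P.flip b.flip eX) (θ : ↥(basedAutGroup P b)) :
    ∃ f : ↥G ≃* ↥G, IsPinnedAut p θ f := by
  classical
  -- Step 1: the isomorphism theorem between the twisted and the plain realization
  obtain ⟨f₀, hf₀, hf₀', hmem, hchar⟩ := hiso hG hT hG hT (h.twist (θ : P.Aut)) h
  have hchar' : ∀ (y : Y) (t : ↥G) (ht : (t : GL (Fin N) k) ∈ T),
      charOfWeight eX (autCoweightAct (θ : P.Aut) y)
          ⟨((f₀ t : ↥G) : GL (Fin N) k), (hmem t).mpr ht⟩ =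
        charOfWeight eX y ⟨(t : GL (Fin N) k), ht⟩ := by
    intro y t ht
    rw [hchar, charOfWeight_twistX]
  -- Step 2: the scalars `c i` with `f₀ (u_i (x)) = u_{θ i} (c_i x)`
  have hU : rootSubgroup_unique (G := G) (T := T) := h.rootSubgroup_unique_of_charZero
  have hroot : ∀ i : ι, Additive.toMul (eX.symm (P.flip.root i)) ∈ roots G T :=
    h.toMul_symm_root_mem
  have hcomp : ∀ i : ↥b.flip.support, IsRootHom G T hT.1
      (charOfWeight eX (P.flip.root (basedIndex θ i : ι))) (f₀.toMonoidHom.comp (p.rootHom i)) := by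
    intro i
    refine (p.isRootHom i).comp_mulEquiv f₀ hf₀ hf₀' hmem (fun t ht => ?_)
    rw [coe_basedIndex, RootPairing.flip_root, ← autCoweightAct_coroot]
    exact hchar' _ t ht
  have hc : ∀ i : ↥b.flip.support, ∃ c : kˣ, ∀ x : k,
      f₀ (p.rootHom i (Multiplicative.ofAdd x)) =
        p.rootHom (basedIndex θ i) (Multiplicative.ofAdd ((c : k) * x)) := by
    intro i
    obtain ⟨c, hc, -⟩ := hU.existsUnique_mul hG hT (hroot (basedIndex θ i : ι))
      (p.isRootHom (basedIndex θ i)) (hcomp i)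
    exact ⟨c, hc⟩
  choose c hc using hc
  -- Step 3: `t₀ ∈ T` with `α^∨_{θ i}(t₀) = (c i)⁻¹`
  let θi : ↥b.flip.support ≃ ↥b.flip.support :=
    (RootPairing.Equiv.indexHom P (θ : P.Aut)).subtypeEquiv fun j => (θ.2 j).symm
  have hθi : ∀ i, θi i = basedIndex θ i := fun _ => rfl
  obtain ⟨t₀, ht₀⟩ := exists_forall_charOfWeight_root_eq hT.2.1 eX b.flip
    fun j => (c (θi.symm j))⁻¹
  have ht₀' : ∀ i : ↥b.flip.support,
      charOfWeight eX (P.flip.root (basedIndex θ i : ι)) t₀ = (c i)⁻¹ := by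
    intro i
    rw [← hθi, ht₀ (θi i), Equiv.symm_apply_apply]
  -- Step 4: `f = Int(t₀) ∘ f₀`
  set tG : ↥G := ⟨(t₀ : GL (Fin N) k), hT.1 t₀.2⟩ with htG
  refine ⟨f₀.trans (MulAut.conj tG), ?_, ?_, ?_, ?_, ?_⟩
  · obtain ⟨Q, hQ⟩ := hf₀.comp_of_subtype_comp (isAlgebraicGL_subtype_comp_conj tG)
    exact ⟨Q, fun g d => hQ g d⟩
  · have halg : MonoidHom.IsAlgebraicGL (G.subtype.comp (MulAut.conj tG).symm.toMonoidHom) := by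
      have e : (MulAut.conj tG).symm = MulAut.conj tG⁻¹ := by
        rw [map_inv]; rfl
      rw [e]
      exact isAlgebraicGL_subtype_comp_conj tG⁻¹
    obtain ⟨Q, hQ⟩ := halg.comp_of_subtype_comp hf₀'
    exact ⟨Q, fun g d => hQ g d⟩
  · intro g
    have ht₀G : ((tG : ↥G) : GL (Fin N) k) ∈ T := t₀.2
    rw [MulEquiv.trans_apply, MulAut.conj_apply, ← hmem g, Subgroup.coe_mul, Subgroup.coe_mul,
      Subgroup.coe_inv, Subgroup.mul_mem_cancel_right T (T.inv_mem ht₀G),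
      Subgroup.mul_mem_cancel_left T ht₀G]
  · intro y t ht
    have hft : ((f₀ t : ↥G) : GL (Fin N) k) ∈ T := (hmem t).mpr ht
    have e : (⟨(((f₀.trans (MulAut.conj tG)) t : ↥G) : GL (Fin N) k),
        T.mul_mem (T.mul_mem t₀.2 hft) (T.inv_mem t₀.2)⟩ : ↥T) =
        ⟨((f₀ t : ↥G) : GL (Fin N) k), hft⟩ := by
      have hc' := hT.2.1.2.1.is_comm.comm t₀ ⟨((f₀ t : ↥G) : GL (Fin N) k), hft⟩
      apply Subtype.ext
      change (t₀ : GL (Fin N) k) * ((f₀ t : ↥G) : GL (Fin N) k) * (t₀ : GL (Fin N) k)⁻¹ = _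
      rw [mul_inv_eq_iff_eq_mul]
      exact congrArg Subtype.val hc'
    rw [← hchar' y t ht]
    exact congrArg (fun s : ↥T => (charOfWeight eX (autCoweightAct (θ : P.Aut) y)) s) e
  · intro i x
    rw [MulEquiv.trans_apply, MulAut.conj_apply]
    have hx := hc i (Multiplicative.toAdd x)
    rw [ofAdd_toAdd] at hx
    rw [hx]
    obtain ⟨-, -, hconj⟩ := p.isRootHom (basedIndex θ i)
    have e := hconj t₀ ((c i : k) * Multiplicative.toAdd x)
    have hincl : Subgroup.inclusion hTG t₀ = tG := rfl
    rw [hincl] at e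
    rw [e, ht₀' i, Units.inv_mul_cancel_left, ofAdd_toAdd]

/-- **The L-action attached to a pinning** (Borel, Corvallis 1979, §2.1; granted the isomorphism
theorem `chevalley_isomorphism`): the homomorphism `Aut(P, b) → Aut(G)` sending a based
automorphism `θ` to the pinned automorphism attached to it (`IsPinnedAut.exists`, a choice made
unique by `IsPinnedAut.unique`); it is multiplicative by uniqueness (`IsPinnedAut.trans`).
[cite: BorelCorvallis1979, §2.1] -/
def pinnedLift [IsAlgClosed k] [CharZero k] [Finite ι]
    (hiso : chevalley_isomorphism (k := k) (ι := ι) (X := Y) (Y := X) (G := G) (T := T) (G' := G)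
      (T' := T))
    (hG : IsConnectedReductive G) (hT : IsMaximalTorusIn T G) (h : IsRootDatumOf G T P.flip eX eY)
    (p : Pinning G T hTG P.flip b.flip eX) : ↥(basedAutGroup P b) →* MulAut ↥G where
  toFun θ := (IsPinnedAut.exists hiso hG hT h p θ).choose
  map_one' := IsPinnedAut.eq_refl_of_one hG hT h (IsPinnedAut.exists hiso hG hT h p 1).choose_spec
  map_mul' θ₁ θ₂ :=
    IsPinnedAut.unique hG hT h (IsPinnedAut.exists hiso hG hT h p (θ₁ * θ₂)).choose_spec
      (((IsPinnedAut.exists hiso hG hT h p θ₁).choose_spec).trans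
        (IsPinnedAut.exists hiso hG hT h p θ₂).choose_spec)

/-- `pinnedLift θ` is the pinned automorphism attached to `θ`. [cite: BorelCorvallis1979, §2.1] -/
theorem isPinnedAut_pinnedLift [IsAlgClosed k] [CharZero k] [Finite ι]
    (hiso : chevalley_isomorphism (k := k) (ι := ι) (X := Y) (Y := X) (G := G) (T := T) (G' := G)
      (T' := T))
    (hG : IsConnectedReductive G) (hT : IsMaximalTorusIn T G) (h : IsRootDatumOf G T P.flip eX eY)
    (p : Pinning G T hTG P.flip b.flip eX) (θ : ↥(basedAutGroup P b)) :
    IsPinnedAut p θ (pinnedLift hiso hG hT h p θ) :=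
  (IsPinnedAut.exists hiso hG hT h p θ).choose_spec

end Existence

/-! ### Assembly: the L-group datum and its dual group structure -/

section Assembly

variable {F : Type*} [Field F]
variable {ι X Y : Type*} [AddCommGroup X] [AddCommGroup Y]

/-- **lang.S13 (d) from (c): Borel's construction of the L-group** (Borel, *Automorphic
L-functions*, Corvallis 1979, §I.2 (2.1)–(2.4); Buzzard–Gee 2014, §2.1). Granted, over `ℂ`,
Chevalley's existence theorem (`chevalley_existence`, Springer 10.1.1), the isomorphism theorem
(`chevalley_isomorphism`, Springer 9.6.2 / 16.3.2) and Springer 8.2.4 (i)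
(`isBorelIn_borelOfBase`: `T̂ · ∏_{α^∨ > 0} U_{α^∨}` is a Borel subgroup), the named fact
`exists_dualGroupStr` holds: for a reduced based root datum `(P, b)` with a Galois action
`a : Γ_F → Aut(P, b)` with open kernel, take `Ĝ ≤ GL_N(ℂ)` connected reductive with maximal torus
`T̂` realizing `P^∨` (existence theorem for `P.flip`), `B̂ = B(b^∨)` the Borel subgroup generated
by `T̂` and the positive coroot subgroups (canonical, hence Galois stable), the pinning extracted
from the `SL₂`'s of the realization (`IsRootDatumOf.pinning`), and the L-action
`Γ_F → Aut(P, b) → Aut(Ĝ, B̂, T̂, {u_α})` (`pinnedLift`); its kernel contains `ker a` and is open.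
[cite: BorelCorvallis1979, §I.2 (2.1)–(2.4)] -/
theorem exists_dualGroupStr_of
    (h₁ : chevalley_existence ℂ (ι := ι) (X := Y) (Y := X))
    (h₂ : ∀ {N : ℕ} {G T : Subgroup (GL (Fin N) ℂ)} [IsMulCommutative ↥T],
      chevalley_isomorphism (k := ℂ) (ι := ι) (X := Y) (Y := X) (G := G) (T := T) (G' := G)
        (T' := T))
    (h₃ : ∀ {N : ℕ} {G T : Subgroup (GL (Fin N) ℂ)} [IsMulCommutative ↥T],
      isBorelIn_borelOfBase (k := ℂ) (n := Fin N) (G := G) (T := T) (ι := ι) (X := Y) (Y := X)) :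
    exists_dualGroupStr (F := F) (ι := ι) (X := X) (Y := Y) := by
  intro _ _ _ P _ b a ha
  classical
  haveI : P.flip.IsReduced := RootPairing.isReduced_of_base_int b.flip
  obtain ⟨N, G, T, hTc, eX, eY, hG, hT, h⟩ := h₁ P.flip
  let p := h.pinning b.flip
  let Φ : ↥(basedAutGroup P b) →* MulAut ↥G := pinnedLift h₂ hG hT h p
  have hΦ : ∀ θ, IsPinnedAut p θ (Φ θ) := isPinnedAut_pinnedLift h₂ hG hT h p
  have hker : a.ker ≤ (Φ.comp a).ker := fun σ hσ => by
    rw [MonoidHom.mem_ker] at hσ ⊢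
    rw [MonoidHom.comp_apply, hσ, map_one]
  let L : LGroupData F := ⟨N, G, Φ.comp a, Subgroup.isOpen_mono hker ha⟩
  refine ⟨L,
    { torus := T
      borel := borelOfBase G T P.flip b.flip eX
      torus_comm := hTc
      torus_le_borel := le_borelOfBase G T P.flip b.flip eX
      borel_le := borelOfBase_le P.flip b.flip eX hT.1
      isConnectedReductive := hG
      isMaximalTorus := hT
      eX := eX
      eY := eY
      isBased := isBasedRootDatumOf_borelOfBase h₃ hG hT h b.flip
      pinning := p
      galRoot := a
      isOpen_ker_galRoot := ha
      galAct_torus := fun σ t ht => ((hΦ (a σ)).mem_iff t).mpr ht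
      galAct_borel := fun σ g hg => (hΦ (a σ)).mem_borelOfBase g hg
      isAlgebraic_galAct := fun σ => (hΦ (a σ)).isAlgebraic
      galAct_char := fun σ y t ht => (hΦ (a σ)).charOfWeight_eq y t ht
      galAct_pinning := fun σ i x => (hΦ (a σ)).rootHom_eq i x }, rfl⟩

/-- **lang.S13 (d) from Chevalley's two theorems alone** (Borel, Corvallis 1979, §I.2). Over `ℂ`
the third leaf of `exists_dualGroupStr_of`, Springer 8.2.4 (i) (`isBorelIn_borelOfBase`), is a
theorem (`isBorelIn_borelOfBase_of_charZero` of `BorelOfBaseMaximal.lean`, characteristic `0`),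
so the named fact `exists_dualGroupStr` follows from Chevalley's existence theorem
(`chevalley_existence`, Springer 10.1.1) and the isomorphism theorem (`chevalley_isomorphism`,
Springer 9.6.2 / 16.3.2) at `k = ℂ` — precisely the two theorems Borel quotes when he sets
`ᴸG = ᴸG° ⋊ Γ_F`. [cite: BorelCorvallis1979, §I.2 (2.1)–(2.4)] -/
theorem exists_dualGroupStr_of_chevalley
    (h₁ : chevalley_existence ℂ (ι := ι) (X := Y) (Y := X))
    (h₂ : ∀ {N : ℕ} {G T : Subgroup (GL (Fin N) ℂ)} [IsMulCommutative ↥T],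
      chevalley_isomorphism (k := ℂ) (ι := ι) (X := Y) (Y := X) (G := G) (T := T) (G' := G)
        (T' := T)) :
    exists_dualGroupStr (F := F) (ι := ι) (X := X) (Y := Y) :=
  exists_dualGroupStr_of h₁ h₂ (@fun _ _ _ _ => isBorelIn_borelOfBase_of_charZero)

end Assembly


end Literature.NumberTheory.Automorphic
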